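import Summits.HodgeConjecture.HodgeConjecture.Theses.BiquadraticSecantLift
import Summits.HodgeConjecture.HodgeConjecture.Theorems.Ring2HypothesesWeilComponentsCM
import Literature.AlgebraicGeometry.HodgeTheory.IsoTransport
import HarnessLib
import HarnessLib.Audit

/-!
# Line `birth` (BC3 skeleton, BC5 rung PLAN-ONLY) — crux `BiquadraticSecantLift.MarkmanBiquadraticTwelvefolds` (X1,
# item stmt-HodgeConjecture-22132, route route-HodgeConjecture-BiquadraticSecantLift rev 0, №5 on LADDER-HodgeAV) — v1
# (tribunal-w bc5-witness planner `hodge-biquad-w-1` g0, 2026-08-27; stub list = director REQUESTS l.20410 (3) / J r1 §T3 verbatim)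

HONEST FRAMING. Nothing in this file proves the Hodge conjecture, rung H2 `WeilSixfolds`, or any of the route's cruxes
X1–X3. Three REGISTERED STUBS (sorried) and one PLAN-ONLY RUNG (sorried); every other declaration is proved. Markman's
CM-field paper [C] = arXiv:2509.23079 is an UNREFEREED preprint; its statements are quoted as the in-print MECHANISM the
stubs are bets on, never used as facts.

CRUX (VERBATIM the route decl, concluded BY NAME in `MarkmanBiquadraticTwelvefolds_of` / `…_of_stubs`): for all `d, m ≥ 1`,
`m` not a square, every complex abelian variety `B` with `η : B ⟶ B` of HYPERBOLIC Weil type relative to the biquadratic CM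
field `L = ℚ(√-d, √m) ≅ ℚ[T]/(R_(d,m)(T²))`, `R_(d,m)(S) = S² + 2d(1+m)S + d²(m-1)²` (the minimal polynomial of
`η² = -d(1+√m)²`), of `L`-rank `6` (`e₀ = 2`, `k = 3`, so `dim B = 12`), has all its rational `(3,3)` classes of the
`L`-Weil space `W_L ⊗ ℂ = weilClassesField B η R_(d,m)(T²) 6` algebraic.

## The line (J r1 §T3; [C] Thm 1.1.2 / Prop 10.2.1 / Cor 10.2.3): SECANT ANCHOR on an RM sixfold + SEMIREGULAR TRANSPORT

Dictionary to [C] (§1 pp. 1–5, §10.2 pp. 33–34): Markman's `K` = our `L` (`e = [L:ℚ] = 4`), his `X` = an abelian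
SIXFOLD `X₀` with real multiplication `θ`, `θ ≫ θ = m` (`F = ℚ(√m) = L⁺`), his `X × X̂` = our `X₀ ⊞ X₀` (`X̂₀ ≅ X₀` up to
isogeny by a polarization; algebraicity of classes is invariant under isogenies and isomorphisms), his complex multiplication
`η : K → End_ℚ(X × X̂)` = our `markmanEta X₀ θ d = Φ_d ≫ (𝟙 + θ ⊞ θ)`, `Φ_d = (x, y) ↦ (-d·y, x)` (`Φ_d² = -d`, PROVED:
`weilPhi_comp_weilPhi`), so `η'² = -d(1 + θ)²` has minimal polynomial `R_(d,m)` exactly as the route's `η_(d,m)` on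
`A ⊞ A`; his `d = dim_K H¹ = 4n/e = 24/4 = 6 > 2` ✓ (Prop 10.2.1 needs `d > 2`).

* `stub_markmanMember` (REACH; J: "the polarized hyperbolic L-deformation class of (A ⊞ A, η_(d,m), [E_A ⊕ mE_A]) contains a
  Markman member (X × X̂, η_{Θ,q}) with X a 6-fold with RM by ℚ(√m) and K′ = F(√−q) = L — Landherr/hermitian-form invariants,
  decidable per (d,m)"): typed on ring 2's real carriers as FAMILY SUPPLY pointed at a given hyperbolic Markman member —
  `PointedWeilFamiliesComponentCM R_(d,m) 2 3 [split] (atMarkmanMember d m X₀ θ)`: every `(B, η, h)` of the split-discriminant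
  `(L, 6)`-component carrying a rational `(3,3)` Weil class `c ≠ 0` is joined to `X₀ ⊞ X₀` by a smooth projective
  `(L, 6, split)`-Weil family over a smooth irreducible quasi-projective base with a global class reading `c` at `B` and an
  `L`-Weil class at the Markman fibre. In print: Deligne's universal family over (a level cover of) the CONNECTED hermitian
  symmetric domain of `(L, φ)` (LNM 900 §4, proof of Thm. 4.8), Landherr (same signatures + same `disc ∈ F^×/N(L^×)` ⇒ same
  component), global invariant `(3,3)` sections (theorem of the fixed part). Size M on the carriers (met in print, not in tree).
* `stub_secantPairGeneric6` (ANCHOR; J: "generic B-secant pair on such an X (dim-6 analogue of 2509.23079's genus-4 Example)"):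
  for each `(d, m)` SOME hyperbolic Markman member `(X₀, θ)` has ALL rational `(3,3)` `L`-Weil classes of `X₀ ⊞ X₀`
  algebraic. In print the mechanism is: a GENERIC `B`-secant pair `(F₁, F₂)` of sheaves on `X₀` ([C] Def. p. 3, genericity
  criterion Prop. 1.1.1) ⇒ `κ(ch Φ(F₁ ⊠ F₂^∨))` is algebraic on `X₀ × X̂₀` (`Φ` = Orlov's equivalence, an algebraic
  correspondence, [C] §10.1) and its degree-`6` part projects to a NON-ZERO element of `HW` ([C] Prop. 10.2.1 (3)); one
  non-zero algebraic Weil class generates `HW` under `ℚ[η^*]` (`u ↦ (σ(u)⁶)_σ`, 6th powers span `L` over `ℚ`). OPEN: [C] §11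
  constructs secant pairs only for `n = 4` (Jacobians of genus-4 curves, `e = 4`, `d = 4`); NO dimension-6 secant pair is in
  print ([C] p0006 L13: "We postpone for future work the search …"). This is the T3 RUNG CANDIDATE of J r1.
* `stub_semiregularDeformAlgebraic` (TRANSPORT; J: "semiregularity of E = Φ(F₁ ⊠ F₂^∨) + Thm 1.1.2 second half ⇒ algebraicity
  of HW on the whole deformation class — the open research content"): the Markman-ANCHORED δ-restricted variational Hodge
  statement on the `(L, 6, split)` component — along every smooth projective `(L, 6, split)`-Weil family, a global class with
  fibrewise rational `(3,3)` restrictions that is ALGEBRAIC at a MARKMAN fibre is algebraic at every fibre. WEAKER than ring 2's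
  `WeilVariationalHodgeComponentCM R_(d,m) 2 3 [split]` (PROVED: `semiregularDeformAt_of_weilVariationalHodgeComponentCM`), hence a
  case of HC. In print the mechanism is: an (equivariantly) SEMIREGULAR representative `E = Φ(F₁ ⊠ F₂^∨)` at the Markman fibre
  (Buchweitz–Flenner 2003 Thm. 5.2 / Bloch 1972 (7.4)) makes `κ(E)` deform as an algebraic class along the algebraic base
  ([C] p. 5 quoting [M2] = arXiv:2502.03415 Thm. 1.5.1 for `F = ℚ`, genus 3), and [C] Thm. 1.1.2 (2nd sentence) =
  Cor. 10.2.3 gives `HW` at every member. OPEN for `[L:ℚ] = 4` ([C] p. 5: "We postpone for future work the search for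
  semiregular B-secant sheaves for CM-fields with [K:ℚ] > 2"). HARDEST STUB.
* `stub_rung_d1_m3` (RUNG, PLAN-ONLY, BC5/T3 designate `X1At 1 3`): X1 at `(d, m) = (1, 3)` — `K = ℚ(i)`, `F = ℚ(√3)`,
  `L = ℚ(i, √3) = ℚ(ζ₁₂)`, `R_(1,3) = S² + 8S + 4`. PLAN: `rung_d1_m3_of_stubsAt` (PROVED) from the three stubs AT `(1,3)`;
  WHY OUTSIDE S's KNOWN REGIME: by the route's X3 (descent) and the DECIDED hermitian-form arithmetic of X2 at
  `(d, δ, m) = (1, [3], 3)` (helper file `Theorems/BiquadraticSecantLiftFalsifier133.lean`, supports stmt-HodgeConjecture-22133: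
  `½Tr(H ⊗ L) = H ⊕ 3H` is split over `L` for `H = diag(1,1,1,-1,-1,-3)`, explicit `η`-stable rational Lagrangian), this cell
  covers the `ℚ(i)`-sixfolds of van Geemen invariant `δ = [3] ≠ [1]` (`3 ∉ N(ℚ(i)^×)`), which are NOT hyperbolic over `ℚ(i)` —
  outside Markman 2025 Thm. 1.5.1 (`Markman2025_weilClasses_algebraic_hyperbolicSixfold`, the tribunal's `s_case`) and outside
  every landed `WeilSixfolds` slice.

COMPOSITION (kernel-checked, no `sorry` outside the four `stub_*`): `x1At_of : MarkmanReachAt d m → SecantAnchorAt d m →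
SemiregularDeformAt d m → X1At d m` (unpack `IsHyperbolicWeilTypeCM` into `(hW, h, pol, Rosati, disc = split)`, take the
anchor member of stub 2, reach it by stub 1, make the global class algebraic at the Markman fibre by stub 2 transported along
the chart (`isRationalClass_/isOfHodgeType_/mem_algebraicClasses_map_iff_of_iso`), transport to `B` by stub 3, read `c`);
`MarkmanBiquadraticTwelvefolds_of : MarkmanReach → SecantAnchor → SemiregularDeform → MarkmanBiquadraticTwelvefolds` and
`MarkmanBiquadraticTwelvefolds_of_stubs`. The hyperbolicity clause (b) of X1's hypothesis (the Lagrangian) is not consumed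
by the composition (only Deligne's (a) `disc = [(-1)³]`); it is kept in `IsMarkmanMember` so that REACH is a same-component
statement.

## Disproof / negatives / dead lines used
No `Cruxes/MarkmanBiquadraticTwelvefolds/Disproof.lean` exists (crux dir empty, 2026-08-27). `ledger negatives --problem
HodgeConjecture`: no statement about `L`-Weil classes of twelvefolds / biquadratic base change is refuted; the refuted
Q11.4-sentence-2 (weak criterion in dim ≥ 3) is NOT used (no stub asks for the weak criterion; stub 3 is the semiregular /
variational statement). DOOR #3 census (pub-hsemireg step0/C, TWISTED-KUNNETH.md §5.6–5.7, DOOR3-THEOREMS-s0-3 Thm. B/B′/C):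
at the INDUCED point `A ⊞ A` the product-type objects `Φ(E₀ ⊠ E′)` (road (A)) are obstructed on all 9 mixed
`β`-directions and line-bundle complexes have `E₁`-mass ≈ 1.55·10⁹ ≫ 196 — so NO stub posits a secant/semiregular object
AT `A ⊞ A`: the anchor is a NON-induced RM sixfold `X₀` (J r1 F3), reached by deformation (stub 1).

## References
[cite: Markman2025SecantRealMultiplication, §1 pp. 1–5 (Thm. 1.1.2, Prop. 1.1.1), §10.2 Prop. 10.2.1 (1)(3), Cor. 10.2.3, §11.2 (preprint, unrefereed)]
[cite: Markman2025SecantWeil, Thm. 1.5.1 (arXiv:2502.03415)] [cite: BuchweitzFlenner2003, Thm. 5.2] [cite: Bloch1972Semiregularity, (7.4)]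
[cite: Deligne1982HodgeCycles, §4 Prop. 4.1, Cor. 4.2, Lemma 4.6, proof of Thm. 4.8, §5] [cite: Landherr1936HermitianForms]
[cite: vanGeemen1994HodgeAV, Lemma 5.2, 5.4–5.5] [cite: CharlesSchnell2014Notes, Conj. 11.3.1] [cite: MoonenZarhin1998WeilClasses, §1]
-/

noncomputable section

-- single-problem summit (Problem = Summit): the mandated namespace repeats `HodgeConjecture`.
set_option linter.dupNamespace false

open CategoryTheory CategoryTheory.Limits
open Literature.AlgebraicGeometry Literature.AlgebraicGeometry.Motives Literature.AlgebraicGeometry.HodgeTheory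
open Literature.AlgebraicGeometry.Deligne1982
open Literature.AlgebraicTopology.SingularHomology
open Literature.AlgebraicGeometry.VanGeemen1994 (pullbackOne)
open Summit.HodgeConjecture.HodgeConjecture.Ring2.Hypotheses

namespace Summit.HodgeConjecture.HodgeConjecture.Cruxes.MarkmanBiquadraticTwelvefolds.Birth

/-! ## §0 Vocabulary: `R_(d,m)`, the Markman action on `X₀ ⊞ X₀`, Markman members, the anchor predicates -/

/-- `R_(d,m)(S) = S² + 2d(1+m)·S + d²(m-1)²` — LITERALLY the route's polynomial (minimal polynomial of `η² = -d(1+√m)²`;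
`E = L = ℚ[T]/(R_(d,m)(T²))`, `F = ℚ[S]/(R_(d,m)) = ℚ(√m)`). -/
def bqPoly (d m : ℕ) : Polynomial ℤ :=
  Polynomial.X ^ 2 + Polynomial.C (2 * (d : ℤ) * (1 + (m : ℤ))) * Polynomial.X +
    Polynomial.C ((d : ℤ) ^ 2 * ((m : ℤ) - 1) ^ 2)

/-- `Φ_d : X₀ ⊞ X₀ ⟶ X₀ ⊞ X₀`, `(x, y) ↦ (-d·y, x)` — multiplication by `√-d` on `X₀ ⊗ ℤ[√-d] = X₀ ⊞ X₀`. -/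
def weilPhi (X₀ : AbelianVariety ℂ) (d : ℕ) : X₀ ⊞ X₀ ⟶ X₀ ⊞ X₀ :=
  biprod.lift (-(d • (biprod.snd : X₀ ⊞ X₀ ⟶ X₀))) biprod.fst

/-- **The Markman action** `η' = Φ_d ≫ (𝟙 + θ ⊞ θ)` on `X₀ ⊞ X₀` (`θ` = real multiplication by `√m` on `X₀`):
`η'² = -d(1 + θ)²`, annihilated by `R_(d,m)(T²)` when `θ² = m` — the rôles of `K` and `F` of the route's
`η_(d,m) = (φ ⊞ φ) ≫ (𝟙 + ψ_m)` on `A ⊞ A` interchanged. [C] §1: `η : K → End_ℚ(X × X̂)`. -/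
def markmanEta (X₀ : AbelianVariety ℂ) (θ : X₀ ⟶ X₀) (d : ℕ) : X₀ ⊞ X₀ ⟶ X₀ ⊞ X₀ :=
  weilPhi X₀ d ≫ (𝟙 (X₀ ⊞ X₀) + biprod.map θ θ)

/-- `Φ_d ≫ Φ_d = -d` (PROVED; the analogue of the route's `φ ≫ φ = -(d • 𝟙 A)`). -/
theorem weilPhi_comp_weilPhi (X₀ : AbelianVariety ℂ) (d : ℕ) :
    weilPhi X₀ d ≫ weilPhi X₀ d = -(d • 𝟙 (X₀ ⊞ X₀)) := by
  apply biprod.hom_ext <;>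
    simp [weilPhi, Preadditive.comp_neg, Preadditive.neg_comp]

/-- **Hyperbolic Markman member of type `(d, m)`**: an abelian SIXFOLD `X₀` with real multiplication `θ`, `θ ≫ θ = m`, such
that `(X₀ ⊞ X₀, η')` is of HYPERBOLIC Weil type relative to `L ≅ ℚ[T]/(R_(d,m)(T²))` of `L`-rank `6` (the route's own
predicate `IsHyperbolicWeilTypeCM`: Weil type `a_σ = 3` at all four embeddings, SOME polarization class with Rosati = complex
conjugation on `L`, `disc = [(-1)³]`, an `η'^*`-stable rational Lagrangian). [C] §1 p. 1, §10.2 p. 34 ("(X × X̂, η, h)"). -/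
def IsMarkmanMember (d m : ℕ) (X₀ : AbelianVariety ℂ) (θ : X₀ ⟶ X₀) : Prop :=
  X₀.dim = 6 ∧ θ ≫ θ = m • 𝟙 X₀ ∧ IsHyperbolicWeilTypeCM (X₀ ⊞ X₀) (markmanEta X₀ θ d) (bqPoly d m) 2 3

/-- **Anchor predicate "the marked fibre IS the Markman member `(X₀, θ)`"** (shape consumed by ring 2's
`PointedWeilFamiliesComponentCM … anchor`): a chart `e : (X₀ ⊞ X₀).X ≅ X` through which the class reads an element of the
`L`-Weil space of `(X₀ ⊞ X₀, η')`. -/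
def atMarkmanMember (d m : ℕ) (X₀ : AbelianVariety ℂ) (θ : X₀ ⟶ X₀) (X : SchemeOver ℂ) (x : complexBetti X (2 * 3)) : Prop :=
  ∃ e : (X₀ ⊞ X₀).X ≅ X,
    complexBetti.map e.hom (2 * 3) x ∈
      weilClassesField (X₀ ⊞ X₀) (markmanEta X₀ θ d) ((bqPoly d m).comp (Polynomial.X ^ 2)) (2 * 3)

/-- **Anchor predicate "the marked fibre is SOME hyperbolic Markman member of type `(d, m)`".** -/
def markmanAnchor (d m : ℕ) (X : SchemeOver ℂ) (x : complexBetti X (2 * 3)) : Prop :=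
  ∃ (X₀ : AbelianVariety ℂ) (θ : X₀ ⟶ X₀), IsMarkmanMember d m X₀ θ ∧ atMarkmanMember d m X₀ θ X x

/-! ## §1 The three stub statements (per `(d, m)` and globally) and the crux at fixed `(d, m)` -/

/-- REACH at `(d, m)`: family supply on the `(L, 6, split)`-component pointed at ANY hyperbolic Markman member. (The `Fact`
binder — `F = ℚ[S]/(R_(d,m))` is a field, needed to name the split class `splitDiscriminantClassCM` — is discharged in the
composition by `IsWeilTypeCM.fact_irreducible_map_real`; all its inhabitants are equal.) -/
def MarkmanReachAt (d m : ℕ) : Prop :=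
  ∀ (X₀ : AbelianVariety ℂ) (θ : X₀ ⟶ X₀) [Fact (Irreducible (realPolyQ (bqPoly d m)))], IsMarkmanMember d m X₀ θ →
    PointedWeilFamiliesComponentCM (bqPoly d m) 2 3 (splitDiscriminantClassCM (bqPoly d m) 3) (atMarkmanMember d m X₀ θ)

/-- ANCHOR at `(d, m)`: SOME hyperbolic Markman member all of whose rational `(3,3)` `L`-Weil classes are algebraic (ambient
dimension written `2·3·2 = 12` as in ring 2's anchor-validity shape). -/
def SecantAnchorAt (d m : ℕ) : Prop :=
  ∃ (X₀ : AbelianVariety ℂ) (θ : X₀ ⟶ X₀), IsMarkmanMember d m X₀ θ ∧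
    ∀ c ∈ weilClassesField (X₀ ⊞ X₀) (markmanEta X₀ θ d) ((bqPoly d m).comp (Polynomial.X ^ 2)) (2 * 3),
      IsRationalClass c → IsOfHodgeType (2 * 3 * 2) (X₀ ⊞ X₀).X (2 * 3) 3 3 c → c ∈ algebraicClasses (X₀ ⊞ X₀).X 3

/-- TRANSPORT at `(d, m)`: the Markman-ANCHORED, split-restricted, Weil-confined variational Hodge statement on the
`(L, 6, split)`-component (literally ring 2's `WeilVariationalHodgeComponentCM R_(d,m) 2 3 [split]` with the algebraic fibre
required to be a hyperbolic Markman fibre). -/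
def SemiregularDeformAt (d m : ℕ) : Prop :=
  ∀ ⦃𝒳 S : SchemeOver ℂ⦄ (f : 𝒳 ⟶ S) [Fact (Irreducible (realPolyQ (bqPoly d m)))], IsSmoothProjectiveFamily f (2 * 3 * 2) →
    IsQuasiProjectiveOver 𝒳 → IsQuasiProjectiveOver S → IrreducibleSpace S.left →
    AlgebraicGeometry.Smooth S.hom →
    ∀ (W : complexBetti 𝒳 (2 * 3)),
      (∀ s : ComplexPoints S,
        IsRationalClass (complexBetti.map (fiberι f s) (2 * 3) W) ∧
          IsOfHodgeType (2 * 3 * 2) (fiberOver f s) (2 * 3) 3 3 (complexBetti.map (fiberι f s) (2 * 3) W)) →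
      HasWeilChartsOfDiscCM (bqPoly d m) 2 3 (splitDiscriminantClassCM (bqPoly d m) 3) f W →
      ∀ s₀ : ComplexPoints S, markmanAnchor d m (fiberOver f s₀) (complexBetti.map (fiberι f s₀) (2 * 3) W) →
        complexBetti.map (fiberι f s₀) (2 * 3) W ∈ algebraicClasses (fiberOver f s₀) 3 →
        ∀ s : ComplexPoints S,
          complexBetti.map (fiberι f s) (2 * 3) W ∈ algebraicClasses (fiberOver f s) 3

/-- **X1 at fixed `(d, m)`** — the crux's body with `R_(d,m) = bqPoly d m` (the RUNG `X1At 1 3` is its `(1,3)` instance). -/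
def X1At (d m : ℕ) : Prop :=
  ∀ (B : AbelianVariety ℂ) (η : B ⟶ B), IsHyperbolicWeilTypeCM B η (bqPoly d m) 2 3 →
    ∀ c ∈ weilClassesField B η ((bqPoly d m).comp (Polynomial.X ^ 2)) 6,
      IsRationalClass c → IsOfHodgeType B.dim B.X 6 3 3 c → c ∈ algebraicClasses B.X 3

/-- REACH, all `(d, m)`. -/
def MarkmanReach : Prop := ∀ d m : ℕ, 0 < d → 0 < m → ¬ IsSquare m → MarkmanReachAt d m

/-- ANCHOR, all `(d, m)`. -/
def SecantAnchor : Prop := ∀ d m : ℕ, 0 < d → 0 < m → ¬ IsSquare m → SecantAnchorAt d m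

/-- TRANSPORT, all `(d, m)`. -/
def SemiregularDeform : Prop := ∀ d m : ℕ, 0 < d → 0 < m → ¬ IsSquare m → SemiregularDeformAt d m

/-! ## §2 Registered stubs (the ONLY sorries of this file) -/

/-- **STUB 1 — `stub_markmanMember` (REACH).** For every `(d, m)` and every hyperbolic Markman member `(X₀, θ)` of type
`(d, m)`: `(L, 6, split)`-Weil families pointed at `X₀ ⊞ X₀` through every `(B, η, h)` of the split component carrying a
non-zero rational `(3,3)` Weil class. Technique: Deligne's family over the hermitian symmetric domain of `(L, φ)` + level
structure (algebraic, smooth, irreducible base), Landherr's classification (equal invariants ⇒ same connected component),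
theorem of the fixed part for the global class. WHY IT MIGHT FAIL: only as typed — the carriers' `IsSmoothProjectiveFamily` /
`HasWeilChartsOfDiscCM` rendering of Deligne's family is not in the tree (ring 2 keeps the CM-pointed analogue
`CMPointedWeilFamiliesComponentCM` as a typed supply hypothesis); mathematically met in print.
[cite: Deligne1982HodgeCycles, §4 Prop. 4.1 and proof of Thm. 4.8] [cite: Landherr1936HermitianForms] -/
theorem stub_markmanMember : MarkmanReach := by
  sorry

/-- **STUB 2 — `stub_secantPairGeneric6` (ANCHOR; T3 rung candidate).** For every `(d, m)` some hyperbolic Markman member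
`(X₀, θ)` — an RM-by-`√m` abelian sixfold with `X₀ ⊞ X₀` hyperbolic of Weil type relative to `L` — has all rational `(3,3)`
`L`-Weil classes of `X₀ ⊞ X₀` algebraic. Technique: a GENERIC `B`-secant pair of sheaves on `X₀` ([C] Prop. 1.1.1 /
Prop. 10.2.1 (3): `κ₆(ch Φ(F₁ ⊠ F₂^∨))` projects to a non-zero ALGEBRAIC element of `HW(X₀ × X̂₀)`), then `ℚ[η^*]·c₀ = HW`;
candidate `X₀`: `S³` for an abelian surface `S` with RM by `ℤ[√m]` (Humbert surface), or an RM Jacobian. The existence of a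
hyperbolic Markman member for each `(d, m)` (hermitian forms over `L`, decidable) is part of the stub. WHY IT MIGHT FAIL: no
secant pair in dimension 6 is in print ([C] §11 treats `n = 4` only); the genericity criterion may fail for every
`B`-secant pair on decomposable `X₀ = S³`. [cite: Markman2025SecantRealMultiplication, Prop. 1.1.1, Prop. 10.2.1 (3), Cor. 10.2.3, §11.2 (preprint, unrefereed)] -/
theorem stub_secantPairGeneric6 : SecantAnchor := by
  sorry

/-- **STUB 3 — `stub_semiregularDeformAlgebraic` (TRANSPORT; HARDEST).** The Markman-anchored split-restricted Weil-confined
variational Hodge statement on the `(L, 6, split)`-component, all `(d, m)`. Technique: an equivariantly SEMIREGULAR secant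
object `E = Φ(F₁ ⊠ F₂^∨)` at the Markman fibre (Buchweitz–Flenner semiregularity ⇒ the class of `E` stays algebraic along
every algebraic deformation keeping it Hodge; [C] Thm. 1.1.2 first half keeps `κ(E)` Hodge on the whole component), then
[C] Cor. 10.2.3. WHY IT MIGHT FAIL: it is an instance of Grothendieck's variational Hodge conjecture (Charles–Schnell 11.3.1),
known for no Weil component with `e₀ ≥ 2`; semiregular secant sheaves are known only for `F = ℚ`, genus 3 ([M2] Thm. 1.5.1),
and the weak criterion (Q11.4 sentence 2) is refuted in dim ≥ 3 (negatives index) — full semiregularity is required.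
[cite: BuchweitzFlenner2003, Thm. 5.2] [cite: Markman2025SecantRealMultiplication, Thm. 1.1.2, Cor. 10.2.3, p. 5 (preprint, unrefereed)] [cite: CharlesSchnell2014Notes, Conj. 11.3.1] -/
theorem stub_semiregularDeformAlgebraic : SemiregularDeform := by
  sorry

/-- **RUNG (BC5 / T3 designate, PLAN-ONLY) — `stub_rung_d1_m3`: X1 at `(d, m) = (1, 3)`, `L = ℚ(i, √3) = ℚ(ζ₁₂)`.**
PLAN: `rung_d1_m3_of_stubsAt` from the three stubs at `(1, 3)` — REACH/(1,3) (Deligne family + Landherr over `ℚ(ζ₁₂)`),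
ANCHOR/(1,3) (a generic secant pair on ONE RM-by-`√3` sixfold, e.g. `S³`, `S` on the Humbert surface of discriminant 12),
TRANSPORT/(1,3) (semiregular `Φ(F₁ ⊠ F₂^∨)`). WHY OUTSIDE S's KNOWN REGIME: with X3 (descent) and the DECIDED X2 arithmetic
at `(1, [3], 3)` (`Theorems/BiquadraticSecantLiftFalsifier133`), `X1At 1 3` yields the Weil classes of the `ℚ(i)`-sixfolds of
invariant `δ = [3]`, not hyperbolic over `ℚ(i)` (`3 ∉ N(ℚ(i)^×)`), hence outside `Markman2025_weilClasses_algebraic_hyperbolicSixfold`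
and outside every landed `WeilSixfolds` slice. Not used by the composition (it is the `(1,3)` instance OF the crux: `x1At_of_crux`). -/
theorem stub_rung_d1_m3 : X1At 1 3 := by
  sorry

/-! ## §3 Proved glue: upper bound for STUB 3, the composition at fixed `(d, m)`, the rung plan, the crux BY NAME -/

/-- STUB 3 at `(d, m)` is implied by ring 2's δ-VHC of the component (forget that the algebraic fibre is a Markman fibre);
in particular it is a CASE of the Hodge conjecture (`weilVariationalHodgeComponentCM_of_hodgeConjecture`, part VII-D). -/
theorem semiregularDeformAt_of_weilVariationalHodgeComponentCM (d m : ℕ)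
    [Fact (Irreducible (realPolyQ (bqPoly d m)))]
    (hV : WeilVariationalHodgeComponentCM (bqPoly d m) 2 3 (splitDiscriminantClassCM (bqPoly d m) 3)) :
    SemiregularDeformAt d m := by
  intro 𝒳 S f _ hf h𝒳 hS hirrS hsm W hWs hch s₀ _ hs₀ s
  exact hV f hf h𝒳 hS hirrS hsm W hWs hch ⟨s₀, hs₀⟩ s

/-- The crux at `(d, m)` gives the rung-shaped statement `X1At d m` (definitional: `bqPoly d m` is the route's polynomial). -/
theorem x1At_of_crux (h : Summit.HodgeConjecture.HodgeConjecture.Theses.BiquadraticSecantLift.MarkmanBiquadraticTwelvefolds)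
    (d m : ℕ) (hd : 0 < d) (hm : 0 < m) (hsq : ¬ IsSquare m) : X1At d m :=
  fun B η hH c hc hcQ hcH => h d m hd hm hsq B η hH c hc hcQ hcH

/-- **COMPOSITION AT FIXED `(d, m)`** (no sorry): REACH ∧ ANCHOR ∧ TRANSPORT at `(d, m)` ⟹ X1 at `(d, m)`. -/
theorem x1At_of (d m : ℕ) (h1 : MarkmanReachAt d m) (h2 : SecantAnchorAt d m) (h3 : SemiregularDeformAt d m) :
    X1At d m := by
  intro B η hH c hc hcQ hcH
  obtain ⟨hW, h, hpol, hros, hdisc, -⟩ := hH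
  haveI : Fact (Irreducible (realPolyQ (bqPoly d m))) := hW.fact_irreducible_map_real
  by_cases hc0 : c = 0
  · rw [hc0]; exact Submodule.zero_mem _
  obtain ⟨X₀, θ, hM, halg⟩ := h2
  obtain ⟨𝒳, S, f, s₁, s₀, ι, W, hf, h𝒳, hS, hirrS, hsm, hWs, hch, hread, hanch⟩ :=
    h1 X₀ θ hM B η h hW hpol hros hdisc c hc hcQ hcH hc0
  obtain ⟨e, he⟩ := hanch
  have hs₀ : complexBetti.map (fiberι f s₀) (2 * 3) W ∈ algebraicClasses (fiberOver f s₀) 3 := by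
    have hQ := (isRationalClass_map_iff_of_iso e).2 (hWs s₀).1
    have hT := (isOfHodgeType_map_iff_of_iso (n := 2 * 3 * 2) e).2 (hWs s₀).2
    exact (mem_algebraicClasses_map_iff_of_iso e).1 (halg _ he hQ hT)
  have h1' : complexBetti.map (fiberι f s₁) (2 * 3) W ∈ algebraicClasses (fiberOver f s₁) 3 :=
    h3 f hf h𝒳 hS hirrS hsm W hWs hch s₀ ⟨X₀, θ, hM, e, he⟩ hs₀ s₁
  rw [← hread]
  exact (mem_algebraicClasses_map_iff_of_iso ι).2 h1'

/-- **THE RUNG'S PLAN** (no sorry): the three stubs AT `(1, 3)` give `X1At 1 3`. -/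
theorem rung_d1_m3_of_stubsAt (h1 : MarkmanReachAt 1 3) (h2 : SecantAnchorAt 1 3) (h3 : SemiregularDeformAt 1 3) :
    X1At 1 3 :=
  x1At_of 1 3 h1 h2 h3

/-- **COMPOSITION — concludes the crux BY NAME** (no sorry):
`stub_markmanMember → stub_secantPairGeneric6 → stub_semiregularDeformAlgebraic → MarkmanBiquadraticTwelvefolds`. -/
theorem MarkmanBiquadraticTwelvefolds_of (h1 : MarkmanReach) (h2 : SecantAnchor) (h3 : SemiregularDeform) :
    Summit.HodgeConjecture.HodgeConjecture.Theses.BiquadraticSecantLift.MarkmanBiquadraticTwelvefolds := by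
  intro d m hd hm hsq B η hH c hc hcQ hcH
  exact x1At_of d m (h1 d m hd hm hsq) (h2 d m hd hm hsq) (h3 d m hd hm hsq) B η hH c hc hcQ hcH

/-- The crux from the registered stubs (sorries live only inside the three `stub_*` above). -/
theorem MarkmanBiquadraticTwelvefolds_of_stubs :
    Summit.HodgeConjecture.HodgeConjecture.Theses.BiquadraticSecantLift.MarkmanBiquadraticTwelvefolds :=
  MarkmanBiquadraticTwelvefolds_of stub_markmanMember stub_secantPairGeneric6 stub_semiregularDeformAlgebraic

end Summit.HodgeConjecture.HodgeConjecture.Cruxes.MarkmanBiquadraticTwelvefolds.Birth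

end
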